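/-
Copyright (c) 2026 the pub-hodgecm-mathlib formalisation cell (harness21).  Prover seat hodgecm-mathlib-K2E5-p17 (g2),
Track B «K2-LIT» ∕ h413 (stmt-HodgeConjecture-24833), engine E5 «TamagawaUnitary», unit G, deal (31) organ (O5f): THE ARCHIMEDEAN BASE GLUE —
the product of the per-place bases `(τ_w)|_{range Nrd_w}` IS the global base `(⊗_w τ_w)|_{im_∞(h)}` of ★ LAYER 3's `hArch`.  2026-09-04.
-/
import Summits.HodgeConjecture.HodgeConjecture.Theorems.K2E5QuatArchKerPi                -- ★ (O5c) (K2E5-p04 (g2), p856420): `quatArchNrdRangePiEquiv`, `coe_quatArchNrdImage_eq_pi` (+ ★ (O3)∕(O3b))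
import Summits.HodgeConjecture.HodgeConjecture.Theorems.K2E5FixedIdeleBaseComparison      -- ★ (O6) FILE B (K2E5-p10 (g2)): `archBaseMeasure`, `archBaseMeasure_apply`, `borelSpace_pi_units`, `secondCountableTopology_units_real`
import HarnessLib

/-!
# K2_E5 road (h413 = stmt-HodgeConjecture-24833), unit G, deal (31) organ (O5f) `K2E5QuatArchBasePi`: `(Π_w ≃)_* ⊗_w (τ_w|_{range Nrd_w}) = (⊗_w τ_w)|_{im_∞(h)}`

Cell `pub/hodgecm-mathlib` (D-0151), Track B; dealer K2E5-plan (g2) SWEEP #14 (b) ∕ #15 (a) ∕ (O5) split 01:07:47Z; offered 01:21Z as a second hand to the (O5e) lead K2E5-p04 (g2).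
THE POINT.  The (O5e) head (`K2E5QuatArchPinGlobal`, K2E5-p04 (g2)) globalises K2E5-p22 (g2)'s per-place pins (H) through ★ (O2) `haarPinPi`, whose base is a PRODUCT `Measure.pi ν_w` of
per-place base measures on `Π_w ↥(range Nrd_w)`; ★ LAYER 3's hypothesis `hArch` (this seat, p856402 ∕ p856428) wants the base as `C_∞ • archBaseMeasure L τ (quatArchNrdImage L h hdet)` =
`C_∞ • (⊗_w τ_w).comap Subtype.val` on the GLOBAL image `↥(im_∞(h))`, `im_∞(h) = Π_w range Nrd_w` (★ (O5c) `coe_quatArchNrdImage_eq_pi`).  This file is the dictionary between the two: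
along ★ (O5c) `quatArchNrdRangePiEquiv : (Π_w ↥(range Nrd_w)) ≃ₜ* ↥(im_∞(h))` (identity on values),
* §1 `image_val_preimage_pi` — the gluing carries boxes to boxes: `↑(e.symm ⁻¹' Π_w s_w) = Π_w ↑s_w`;
* §2 **`map_quatArchNrdRangePiEquiv_pi_comap`** — `e_* (⊗_w (τ_w).comap val) = archBaseMeasure L τ (quatArchNrdImage L Ha hdet)` (Mathlib `Measure.pi_eq` on boxes, `Measure.pi_pi`,
  `MeasurableEmbedding.comap_apply`; every `range Nrd_w` is open — projection of the open box ★ (O3b) `isOpen_quatArchNrdImage`);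
* §3 `pi_smul_eq_prod_smul_pi` (generic: `⊗_w (c_w • μ_w) = (∏_w c_w) • ⊗_w μ_w`) and **`map_quatArchNrdRangePiEquiv_pi_smul_comap`** — with per-place constants:
  `e_* (⊗_w (c_w • (τ_w).comap val)) = (∏_w c_w) • archBaseMeasure L τ (quatArchNrdImage …)` (so `c_w = 2³` for all `w` gives `C_∞ = 2^{3d}`, `d = #W`);
* §4 `isOpen_range_quatArchNrd` (per-place openness, from the open product).

RULES KEPT: THEOREMS ONLY — no `def`, no `instance`, no `notation`, no named fact, no `sorry`, no `Cruxes/…/Lines` import.  Lane `--supports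
stmt-HodgeConjecture-24833 --as helper`.  HONEST LABEL: HC_CM is proved only modulo the 7 printed citations (2 remaining named inputs: hLiu418 =
stmt-HodgeConjecture-24832, h413 = stmt-HodgeConjecture-24833) until rung 0 closes; bookkeeping, retires nothing by itself.

## References
* [VignerasLNM800] M.-F. Vignéras, *Arithmétique des algèbres de quaternions*, LNM 800 (1980) — Ch. III §1–§2 (`n(H_v^×)`, product measures on `K_A^×`).
* [WeilBNT1967] A. Weil, *Basic Number Theory* (1967) — Ch. IV §4 (`k_∞^× = Π_w k_w^×`).
* [Folland1995] G. B. Folland, *A Course in Abstract Harmonic Analysis* (1995) — §2.6 Thm. 2.49, (2.52) (product measures).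
-/

set_option autoImplicit false
set_option linter.dupNamespace false   -- `Summit.HodgeConjecture.HodgeConjecture.…` (D-0017 nested layout; lakefile exemption for Summits)

noncomputable section

namespace Summit.HodgeConjecture.HodgeConjecture.Cruxes.H413.K2E5QuatArchBasePi

open MeasureTheory Measure NumberField NumberField.InfinitePlace IsDedekindDomain Topology
open scoped Matrix MatrixGroups ENNReal NNReal Classical
open Literature.NumberTheory.Automorphic
open Summit.HodgeConjecture.HodgeConjecture.Cruxes.H413.K2E5QuatAdelicProdDecomposition
open Summit.HodgeConjecture.HodgeConjecture.Cruxes.H413.K2E5QuatArchLocal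
open Summit.HodgeConjecture.HodgeConjecture.Cruxes.H413.K2E5QuatArchNrd
open Summit.HodgeConjecture.HodgeConjecture.Cruxes.H413.K2E5QuatArchNrdOpen
open Summit.HodgeConjecture.HodgeConjecture.Cruxes.H413.K2E5QuatArchKerPi
open Summit.HodgeConjecture.HodgeConjecture.Cruxes.H413.K2E5FixedIdeleBaseComparison

variable (L : Type) [Field L] [NumberField L] [IsCMField L] (Ha : Matrix (Fin 2) (Fin 2) L) (hdet : Ha.det ≠ 0)

/-! ## §4 (stated first) Every `range Nrd_w` is open in `ℝˣ` -/

omit [NumberField L] [IsCMField L] in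
/-- The arch image `im_∞(h) = Π_w range Nrd_w` is non-empty as a box. [folklore] -/
theorem pi_range_quatArchNrd_nonempty :
    (Set.pi Set.univ fun w : {w : InfinitePlace L // IsComplex w} => Set.range (quatArchNrd L Ha w hdet)).Nonempty :=
  ⟨1, fun _ _ => ⟨1, map_one _⟩⟩

/-- **`range Nrd_w` is open in `ℝˣ`** at every complex place `w` (projection `eval w` — an open map — of the open box ★ (O3b) `isOpen_quatArchNrdImage` = ★ (O5c)
`coe_quatArchNrdImage_eq_pi`, Mathlib `Set.eval_image_univ_pi`). [cite: VignerasLNM800, Ch. III §2] -/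
theorem isOpen_range_quatArchNrd (w : {w : InfinitePlace L // IsComplex w}) : IsOpen (Set.range (quatArchNrd L Ha w hdet)) := by
  rw [← Set.eval_image_univ_pi (pi_range_quatArchNrd_nonempty L Ha hdet) (i := w), ← coe_quatArchNrdImage_eq_pi L Ha hdet]
  exact isOpenMap_eval w _ (isOpen_quatArchNrdImage L Ha hdet)

/-! ## §1 The gluing carries boxes to boxes -/

/-- `↑(e.symm ⁻¹' (Π_w s_w)) = Π_w ↑s_w` for the gluing `e = quatArchNrdRangePiEquiv` (identity on values) and subsets `s_w ⊆ ↥(range Nrd_w)`. [folklore] -/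
theorem image_val_preimage_pi (s : ∀ w : {w : InfinitePlace L // IsComplex w}, Set ↥(quatArchNrd L Ha w hdet).range) :
    (Subtype.val : ↥(quatArchNrdImage L Ha hdet) → ({w : InfinitePlace L // IsComplex w} → ℝˣ)) '' ((quatArchNrdRangePiEquiv L Ha hdet).symm ⁻¹' Set.pi Set.univ s) =
      Set.pi Set.univ fun w => (Subtype.val : ↥(quatArchNrd L Ha w hdet).range → ℝˣ) '' s w := by
  ext x
  constructor
  · rintro ⟨t, ht, rfl⟩ w -
    exact ⟨(quatArchNrdRangePiEquiv L Ha hdet).symm t w, ht w (Set.mem_univ w), coe_quatArchNrdRangePiEquiv_symm_apply L Ha hdet t w⟩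
  · intro hx
    have hxw : ∀ w, ∃ a : ↥(quatArchNrd L Ha w hdet).range, a ∈ s w ∧ (a : ℝˣ) = x w := fun w => hx w (Set.mem_univ w)
    choose a ha hax using hxw
    have hxmem : x ∈ quatArchNrdImage L Ha hdet := by
      rw [← SetLike.mem_coe, coe_quatArchNrdImage_eq_pi L Ha hdet]
      exact fun w _ => by rw [← hax w]; exact (a w).2
    refine ⟨⟨x, hxmem⟩, fun w _ => ?_, rfl⟩
    have hw : (quatArchNrdRangePiEquiv L Ha hdet).symm ⟨x, hxmem⟩ w = a w :=
      Subtype.ext (by rw [coe_quatArchNrdRangePiEquiv_symm_apply, hax w])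
    rw [hw]
    exact ha w

/-! ## §2 `e_* (⊗_w (τ_w).comap val) = archBaseMeasure L τ (im_∞(h))` -/

section Glue

variable [MeasurableSpace ℝˣ] [BorelSpace ℝˣ]

/-- **THE BASE GLUE** (organ (O5f)): for Haar measures `τ_w` on `ℝˣ`, transporting the product of the per-place restricted bases `(τ_w).comap val` (on `↥(range Nrd_w)`) along ★ (O5c)
`quatArchNrdRangePiEquiv` gives ★ (O6)'s global base `archBaseMeasure L τ (quatArchNrdImage L h hdet) = (⊗_w τ_w).comap val`.  (Mathlib `Measure.pi_eq` on boxes: both sides give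
`Π_w s_w` the mass `∏_w τ_w(↑s_w)` — `Measure.pi_pi`, `MeasurableEmbedding.comap_apply` for the open ranges (§4) and the open image ★ (O3b), §1.)
[cite: VignerasLNM800, Ch. III §1–§2] [cite: WeilBNT1967, Ch. IV §4] [cite: Folland1995, §2.6 (2.52)] -/
theorem map_quatArchNrdRangePiEquiv_pi_comap (τ : {w : InfinitePlace L // IsComplex w} → Measure ℝˣ) [∀ w, (τ w).IsHaarMeasure] :
    Measure.map (quatArchNrdRangePiEquiv L Ha hdet)
        (Measure.pi fun w => (τ w).comap (Subtype.val : ↥(quatArchNrd L Ha w hdet).range → ℝˣ)) =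
      archBaseMeasure L τ (quatArchNrdImage L Ha hdet) := by
  haveI := secondCountableTopology_units_real
  haveI := borelSpace_pi_units L
  have hopen : ∀ w, IsOpen (((quatArchNrd L Ha w hdet).range : Subgroup ℝˣ) : Set ℝˣ) := fun w => by
    rw [MonoidHom.coe_range]; exact isOpen_range_quatArchNrd L Ha hdet w
  have hval : ∀ w, MeasurableEmbedding (Subtype.val : ↥(quatArchNrd L Ha w hdet).range → ℝˣ) := fun w => MeasurableEmbedding.subtype_coe (hopen w).measurableSet
  -- the per-place restricted bases are Haar (open subgroups), hence σ-finite
  haveI : ∀ w, LocallyCompactSpace ↥(quatArchNrd L Ha w hdet).range := fun w => (hopen w).locallyCompactSpace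
  haveI : ∀ w, ((τ w).comap (Subtype.val : ↥(quatArchNrd L Ha w hdet).range → ℝˣ)).IsHaarMeasure := fun w =>
    IsHaarMeasure.comap (mH := inferInstance) (τ w) (f := ((quatArchNrd L Ha w hdet).range).subtype) (hopen w).isOpenEmbedding_subtypeVal
  have he : Measurable (quatArchNrdRangePiEquiv L Ha hdet : (∀ w, ↥(quatArchNrd L Ha w hdet).range) → ↥(quatArchNrdImage L Ha hdet)) :=
    (quatArchNrdRangePiEquiv L Ha hdet).continuous.measurable
  have hes : Measurable ((quatArchNrdRangePiEquiv L Ha hdet).symm : ↥(quatArchNrdImage L Ha hdet) → ∀ w, ↥(quatArchNrd L Ha w hdet).range) :=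
    (quatArchNrdRangePiEquiv L Ha hdet).symm.continuous.measurable
  -- it suffices to identify the product on `Π_w ↥(range Nrd_w)` with the pulled-back global base
  suffices h : (Measure.pi fun w => (τ w).comap (Subtype.val : ↥(quatArchNrd L Ha w hdet).range → ℝˣ)) =
      Measure.map (quatArchNrdRangePiEquiv L Ha hdet).symm (archBaseMeasure L τ (quatArchNrdImage L Ha hdet)) by
    rw [h, Measure.map_map he hes]
    have hid : ((quatArchNrdRangePiEquiv L Ha hdet : _ → ↥(quatArchNrdImage L Ha hdet)) ∘ ((quatArchNrdRangePiEquiv L Ha hdet).symm : _ → _)) = id :=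
      funext fun t => (quatArchNrdRangePiEquiv L Ha hdet).apply_symm_apply t
    rw [hid, Measure.map_id]
  refine Measure.pi_eq fun s hs => ?_
  rw [Measure.map_apply hes (MeasurableSet.univ_pi hs), archBaseMeasure_apply L τ (isOpen_quatArchNrdImage L Ha hdet), image_val_preimage_pi,
    Measure.pi_pi (μ := τ)]
  exact Finset.prod_congr rfl fun w _ => ((hval w).comap_apply (τ w) (s w)).symm

/-! ## §3 With per-place constants -/

omit [NumberField L] [IsCMField L] [MeasurableSpace ℝˣ] [BorelSpace ℝˣ] in
/-- `⊗_i (c_i • μ_i) = (∏_i c_i) • ⊗_i μ_i` for σ-finite `μ_i` and constants `c_i : ℝ≥0` (Mathlib `Measure.pi_eq` on boxes, `Measure.pi_pi`, `Finset.prod_mul_distrib`).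
[cite: Folland1995, §2.6 (2.52)] -/
theorem pi_smul_eq_prod_smul_pi {ι : Type} [Fintype ι] {X : ι → Type} [∀ i, MeasurableSpace (X i)] (μ : ∀ i, Measure (X i)) [∀ i, SigmaFinite (μ i)]
    (c : ι → ℝ≥0) : (Measure.pi fun i => c i • μ i) = (∏ i, c i) • Measure.pi μ := by
  refine Measure.pi_eq fun s _ => ?_
  rw [Measure.coe_nnreal_smul_apply, Measure.pi_pi (μ := μ), ENNReal.ofNNReal_finsetProd, ← Finset.prod_mul_distrib]
  exact Finset.prod_congr rfl fun i _ => (Measure.coe_nnreal_smul_apply (c i) (μ i) (s i)).symm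

/-- **THE BASE GLUE WITH PER-PLACE CONSTANTS**: `e_* (⊗_w (c_w • (τ_w).comap val)) = (∏_w c_w) • archBaseMeasure L τ (im_∞(h))` — with `c_w = 2³` at every complex place this is
`2^{3d} • archBaseMeasure …`, `d = #W`, the constant of the (O5e) head. [cite: VignerasLNM800, Ch. III §2] [cite: Folland1995, §2.6 (2.52)] -/
theorem map_quatArchNrdRangePiEquiv_pi_smul_comap (τ : {w : InfinitePlace L // IsComplex w} → Measure ℝˣ) [∀ w, (τ w).IsHaarMeasure]
    (c : {w : InfinitePlace L // IsComplex w} → ℝ≥0) :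
    Measure.map (quatArchNrdRangePiEquiv L Ha hdet)
        (Measure.pi fun w => c w • (τ w).comap (Subtype.val : ↥(quatArchNrd L Ha w hdet).range → ℝˣ)) =
      (∏ w, c w) • archBaseMeasure L τ (quatArchNrdImage L Ha hdet) := by
  haveI := secondCountableTopology_units_real
  have hopen : ∀ w, IsOpen (((quatArchNrd L Ha w hdet).range : Subgroup ℝˣ) : Set ℝˣ) := fun w => by
    rw [MonoidHom.coe_range]; exact isOpen_range_quatArchNrd L Ha hdet w
  haveI : ∀ w, LocallyCompactSpace ↥(quatArchNrd L Ha w hdet).range := fun w => (hopen w).locallyCompactSpace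
  haveI : ∀ w, ((τ w).comap (Subtype.val : ↥(quatArchNrd L Ha w hdet).range → ℝˣ)).IsHaarMeasure := fun w =>
    IsHaarMeasure.comap (mH := inferInstance) (τ w) (f := ((quatArchNrd L Ha w hdet).range).subtype) (hopen w).isOpenEmbedding_subtypeVal
  rw [pi_smul_eq_prod_smul_pi, ENNReal.smul_def, Measure.map_smul, map_quatArchNrdRangePiEquiv_pi_comap, ← ENNReal.smul_def]

end Glue

end Summit.HodgeConjecture.HodgeConjecture.Cruxes.H413.K2E5QuatArchBasePi

end
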